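import Literature.Probability.Percolation.MedialGridDistances
import Literature.Probability.RandomPlanarGeometry.LoopWinding
import Literature.Topology.PlaneTopology.ArgumentIncrement
import HarnessLib

/-!
# The winding number of an interface loop jumps by one across each of its darts

Topic: Probability / Percolation (groundwork for the loop representation of critical bond
percolation on `ℤ²`, Duminil-Copin–Kozlowski–Krachun–Manolescu–Oulamara, arXiv:2012.11672,
§1.1 and §3.5 "loops oriented such that the primal cluster lies on their right/left";
Grimmett, *Percolation* (1999), §11.2).

Let `γ` be a percolation interface on the medial lattice of `ℤ²` (`IsInterfaceLoop`) and let
`(v, f)` be the corner carrying one of its darts (`IsMedialDart`: the dart runs from the midpoint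
of one edge of the face `f` at its corner `v` to the midpoint of the other, *with `v` on its
left*). We prove the **jump relation**
`wind(γ, v) = wind(γ, centre of f) + 1` (`IsInterfaceLoop.wind_meshPoint_eq_wind_faceCenter_add_one`):
the segment from `v` to the centre of `f` crosses the trace of `γ` exactly once, transversally,
at the midpoint of the corner cut of `(v, f)` (`segment_meshPoint_faceCenter_disjoint_cornerCut`:
it misses every other corner cut), the dart crosses it from the positive to the negative side
(`segSide_source_pos`, `segSide_target_neg`), and the crossing defect of
`ArgumentIncrement.lean` (`Path.crossInc_loop`, `Path.crossInc_segment_of_cross`,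
`Path.crossInc_eq_zero`, additivity `crossInc_polylineFrom`) converts the single signed crossing
into the difference of winding numbers. Consequently **every interface loop has a fat point of
non-zero winding number** (`IsInterfaceLoop.exists_fat_wind_ne_zero`): one of `v`, centre of `f`
has non-zero winding number, and both are at distance `≥ √2/4` from the trace
(`MedialGridDistances.lean`). No Jordan curve theorem is used.

## References
* H. Duminil-Copin, K. K. Kozlowski, D. Krachun, I. Manolescu, M. Oulamara, *Rotational
  invariance in critical planar lattice models*, arXiv:2012.11672, §1.1, §3.5 [arXiv201211672].
* G. Grimmett, *Percolation*, 2nd ed., Springer (1999), §11.2 [Grimmett1999].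
-/

noncomputable section

open Complex Metric Set
open scoped Real

namespace Literature.Probability.Percolation

open LatticeModels

/-! ### Coordinates -/

/-- The side function of `ArgumentIncrement.lean` in coordinates. [folklore] -/
theorem segSide_eq (ℓ r z : ℂ) :
    Literature.Topology.PlaneTopology.segSide ℓ r z = (z.im - ℓ.im) * (z.re - r.re) - (z.re - ℓ.re) * (z.im - r.im) := by
  simp only [Literature.Topology.PlaneTopology.segSide, Complex.mul_im, Complex.sub_re, Complex.sub_im, Complex.conj_re,
    Complex.conj_im]
  ring

/-- The lattice point `v` relative to the centre of the face `f`: `v = c_f + σ/2`. [folklore] -/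
theorem meshPoint_one_eq_faceCenter_add {v f : Site 2} (hv : IsCorner v f) :
    meshPoint 1 v = ⟨(faceCenter f).re + cornerSign v f 0 / 2, (faceCenter f).im + cornerSign v f 1 / 2⟩ := by
  have h0 := corner_sub_faceCenter hv 0
  have h1 := corner_sub_faceCenter hv 1
  apply Complex.ext <;> simp <;> linarith

/-- The side of the horizontal-edge midpoint of the corner relative to `[v, c_f]`. [folklore] -/
theorem segSide_medialPoint_cornerEdge_zero {v f : Site 2} (hv : IsCorner v f) :
    Literature.Topology.PlaneTopology.segSide (meshPoint 1 v) (faceCenter f) (medialPoint 1 (cornerEdge v f 0)) =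
      cornerSign v f 0 * cornerSign v f 1 / 4 := by
  rw [segSide_eq, (medialPoint_cornerEdge_eq hv).1, meshPoint_one_eq_faceCenter_add hv]
  ring

/-- The side of the vertical-edge midpoint of the corner relative to `[v, c_f]`. [folklore] -/
theorem segSide_medialPoint_cornerEdge_one {v f : Site 2} (hv : IsCorner v f) :
    Literature.Topology.PlaneTopology.segSide (meshPoint 1 v) (faceCenter f) (medialPoint 1 (cornerEdge v f 1)) =
      -(cornerSign v f 0 * cornerSign v f 1) / 4 := by
  rw [segSide_eq, (medialPoint_cornerEdge_eq hv).2, meshPoint_one_eq_faceCenter_add hv]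
  ring

/-- The orientation rule in terms of signs: the dart of `(v, f)` starts on the horizontal edge iff
the two corner signs agree. [folklore] -/
theorem cornerSign_mul_cornerSign {v f : Site 2} (hv : IsCorner v f) :
    cornerSign v f 0 * cornerSign v f 1 = if v 0 - f 0 = v 1 - f 1 then 1 else -1 := by
  have hc0 := corner_sub_faceCenter hv 0
  have hc1 := corner_sub_faceCenter hv 1
  have hs0 := cornerSign_eq_or v f 0
  have hs1 := cornerSign_eq_or v f 1
  split_ifs with hd
  · have e : ((v 0 : ℤ) : ℝ) - f 0 = (v 1 : ℝ) - f 1 := by exact_mod_cast hd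
    have : cornerSign v f 0 = cornerSign v f 1 := by linarith
    rw [this]
    rcases hs1 with h | h <;> rw [h] <;> norm_num
  · have e : ((v 0 : ℤ) : ℝ) - f 0 ≠ (v 1 : ℝ) - f 1 := by exact_mod_cast hd
    rcases hs0 with h0 | h0 <;> rcases hs1 with h1 | h1
    · exact absurd (show ((v 0 : ℤ) : ℝ) - f 0 = (v 1 : ℝ) - f 1 by linarith) e
    · rw [h0, h1]; norm_num
    · rw [h0, h1]; norm_num
    · exact absurd (show ((v 0 : ℤ) : ℝ) - f 0 = (v 1 : ℝ) - f 1 by linarith) e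

/-- The dart of the corner `(v, f)` starts on the positive side of the segment `[v, c_f]`
(`v` is on its left). [folklore] -/
theorem segSide_source_pos {v f : Site 2} (hv : IsCorner v f) :
    0 < Literature.Topology.PlaneTopology.segSide (meshPoint 1 v) (faceCenter f) (medialPoint 1 (cornerSource v f)) := by
  have key := cornerSign_mul_cornerSign hv
  unfold cornerSource
  split_ifs with hd
  · rw [segSide_medialPoint_cornerEdge_zero hv, key, if_pos hd]; norm_num
  · rw [segSide_medialPoint_cornerEdge_one hv, key, if_neg hd]; norm_num

/-- The dart of the corner `(v, f)` ends on the negative side of the segment `[v, c_f]`.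
[folklore] -/
theorem segSide_target_neg {v f : Site 2} (hv : IsCorner v f) :
    Literature.Topology.PlaneTopology.segSide (meshPoint 1 v) (faceCenter f) (medialPoint 1 (cornerTarget v f)) < 0 := by
  have key := cornerSign_mul_cornerSign hv
  unfold cornerTarget
  split_ifs with hd
  · rw [segSide_medialPoint_cornerEdge_one hv, key, if_pos hd]; norm_num
  · rw [segSide_medialPoint_cornerEdge_zero hv, key, if_neg hd]; norm_num

/-- The dart of the corner `(v, f)` crosses the open segment `(v, c_f)` (at the common midpoint
`c_f + σ/4`). [folklore] -/
theorem exists_mem_cornerCut_mem_openSegment {v f : Site 2} (hv : IsCorner v f) :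
    ∃ p ∈ segment ℝ (medialPoint 1 (cornerSource v f)) (medialPoint 1 (cornerTarget v f)),
      p ∈ openSegment ℝ (meshPoint 1 v) (faceCenter f) := by
  have hP := medialPoint_cornerEdge_eq hv
  have hvc := meshPoint_one_eq_faceCenter_add hv
  refine ⟨⟨(faceCenter f).re + cornerSign v f 0 / 4, (faceCenter f).im + cornerSign v f 1 / 4⟩, ?_, ?_⟩
  · have hseg : segment ℝ (medialPoint 1 (cornerSource v f)) (medialPoint 1 (cornerTarget v f)) =
        cornerCut v f := by
      unfold cornerSource cornerTarget cornerCut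
      split_ifs
      · rfl
      · exact segment_symm _ _ _
    rw [hseg, cornerCut, hP.1, hP.2]
    refine ⟨1 / 2, 1 / 2, by norm_num, by norm_num, by norm_num, ?_⟩
    apply Complex.ext <;> simp <;> ring
  · rw [hvc]
    refine ⟨1 / 2, 1 / 2, by norm_num, by norm_num, by norm_num, ?_⟩
    apply Complex.ext <;> simp <;> ring

/-- A point of the segment `[v, c_f]` is `c_f + a σ / 2` for some `a ∈ [0, 1]`. [folklore] -/
theorem exists_eq_of_mem_segment_meshPoint_faceCenter {v f : Site 2} (hv : IsCorner v f) {p : ℂ}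
    (hp : p ∈ segment ℝ (meshPoint 1 v) (faceCenter f)) :
    ∃ a : ℝ, 0 ≤ a ∧ a ≤ 1 ∧ p.re - (faceCenter f).re = a * cornerSign v f 0 / 2 ∧
      p.im - (faceCenter f).im = a * cornerSign v f 1 / 2 := by
  obtain ⟨a, b, ha, hb, hab, rfl⟩ := hp
  obtain rfl : b = 1 - a := by linarith
  have hvc := meshPoint_one_eq_faceCenter_add hv
  refine ⟨a, ha, by linarith, ?_, ?_⟩
  · simp only [Complex.add_re, Complex.smul_re, smul_eq_mul, hvc]
    ring
  · simp only [Complex.add_im, Complex.smul_im, smul_eq_mul, hvc]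
    ring

/-- **The segment `[v, c_f]` misses the corner cuts of all other faces.** [folklore] -/
theorem segment_meshPoint_faceCenter_disjoint_cornerCut_of_ne {v f v' f' : Site 2} (hv : IsCorner v f)
    (hv' : IsCorner v' f') (hf : f' ≠ f) {p : ℂ} (hp : p ∈ segment ℝ (meshPoint 1 v) (faceCenter f))
    (hp' : p ∈ cornerCut v' f') : False := by
  obtain ⟨a, ha0, ha1, hre, him⟩ := exists_eq_of_mem_segment_meshPoint_faceCenter hv hp
  have hl := l1DistC_eq_of_mem_cornerCut hv' hp'
  unfold l1DistC at hl
  simp only [faceCenter_re, faceCenter_im] at hl hre him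
  have hs0 := cornerSign_eq_or v f 0
  have hs1 := cornerSign_eq_or v f 1
  -- integer offsets of the two face centres
  have key : f' 0 ≠ f 0 ∨ f' 1 ≠ f 1 := by
    by_contra hc
    simp only [not_or, not_not] at hc
    exact hf (funext fun i ↦ by fin_cases i <;> simp [hc.1, hc.2])
  have hpre : p.re - (f' 0 + 1 / 2) = a * cornerSign v f 0 / 2 - ((f' 0 : ℝ) - f 0) := by linarith
  have hpim : p.im - (f' 1 + 1 / 2) = a * cornerSign v f 1 / 2 - ((f' 1 : ℝ) - f 1) := by linarith
  rw [hpre, hpim] at hl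
  -- each term is ≥ |d| - a/2
  have hb0 : |a * cornerSign v f 0 / 2| ≤ a / 2 := by
    rcases hs0 with h | h <;> rw [h, abs_le] <;> constructor <;> linarith
  have hb1 : |a * cornerSign v f 1 / 2| ≤ a / 2 := by
    rcases hs1 with h | h <;> rw [h, abs_le] <;> constructor <;> linarith
  have ht0 := abs_sub_abs_le_abs_sub ((f' 0 : ℝ) - f 0) (a * cornerSign v f 0 / 2)
  have ht1 := abs_sub_abs_le_abs_sub ((f' 1 : ℝ) - f 1) (a * cornerSign v f 1 / 2)
  rw [abs_sub_comm ((f' 0 : ℝ) - f 0)] at ht0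
  rw [abs_sub_comm ((f' 1 : ℝ) - f 1)] at ht1
  rcases key with hd | hd
  · have h1 : (1 : ℝ) ≤ |(f' 0 : ℝ) - f 0| := by
      rw [← Int.cast_sub, ← Int.cast_abs]; exact_mod_cast Int.one_le_abs (sub_ne_zero.2 hd)
    -- then the other term vanishes and `a = 1`
    have hz : |a * cornerSign v f 1 / 2 - ((f' 1 : ℝ) - f 1)| = 0 := by
      apply le_antisymm _ (abs_nonneg _)
      linarith [abs_nonneg (a * cornerSign v f 1 / 2 - ((f' 1 : ℝ) - f 1))]
    have ha : a = 1 := by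
      by_contra hne
      have : a < 1 := lt_of_le_of_ne ha1 hne
      linarith [abs_nonneg (a * cornerSign v f 1 / 2 - ((f' 1 : ℝ) - f 1))]
    rw [abs_eq_zero, ha, one_mul] at hz
    have : (2 : ℝ) * ((f' 1 : ℝ) - f 1) = cornerSign v f 1 := by linarith
    rcases hs1 with h | h <;> rw [h] at this
    · have e : (2 : ℤ) * (f' 1 - f 1) = 1 := by exact_mod_cast this
      omega
    · have e : (2 : ℤ) * (f' 1 - f 1) = -1 := by exact_mod_cast this
      omega
  · have h1 : (1 : ℝ) ≤ |(f' 1 : ℝ) - f 1| := by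
      rw [← Int.cast_sub, ← Int.cast_abs]; exact_mod_cast Int.one_le_abs (sub_ne_zero.2 hd)
    have hz : |a * cornerSign v f 0 / 2 - ((f' 0 : ℝ) - f 0)| = 0 := by
      apply le_antisymm _ (abs_nonneg _)
      linarith [abs_nonneg (a * cornerSign v f 0 / 2 - ((f' 0 : ℝ) - f 0))]
    have ha : a = 1 := by
      by_contra hne
      have : a < 1 := lt_of_le_of_ne ha1 hne
      linarith [abs_nonneg (a * cornerSign v f 0 / 2 - ((f' 0 : ℝ) - f 0))]
    rw [abs_eq_zero, ha, one_mul] at hz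
    have : (2 : ℝ) * ((f' 0 : ℝ) - f 0) = cornerSign v f 0 := by linarith
    rcases hs0 with h | h <;> rw [h] at this
    · have e : (2 : ℤ) * (f' 0 - f 0) = 1 := by exact_mod_cast this
      omega
    · have e : (2 : ℤ) * (f' 0 - f 0) = -1 := by exact_mod_cast this
      omega

/-- **The segment `[v, c_f]` misses the corner cuts of the other corners of `f`.** [folklore] -/
theorem segment_meshPoint_faceCenter_disjoint_cornerCut_of_ne' {v f v' : Site 2} (hv : IsCorner v f)
    (hv' : IsCorner v' f) (hne : v' ≠ v) {p : ℂ} (hp : p ∈ segment ℝ (meshPoint 1 v) (faceCenter f))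
    (hp' : p ∈ cornerCut v' f) : False := by
  obtain ⟨a, ha0, ha1, hre, him⟩ := exists_eq_of_mem_segment_meshPoint_faceCenter hv hp
  obtain ⟨hl, hsg0, hsg1⟩ := (mem_cornerCut_iff hv').1 hp'
  have hs0 := cornerSign_eq_or v f 0
  have hs1 := cornerSign_eq_or v f 1
  have hs0' := cornerSign_eq_or v' f 0
  have hs1' := cornerSign_eq_or v' f 1
  -- `a = 1/2`
  unfold l1DistC at hl
  rw [hre, him] at hl
  have e0 : |a * cornerSign v f 0 / 2| = a / 2 := by
    rcases hs0 with h | h <;> rw [h]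
    · rw [abs_of_nonneg (by linarith)]; ring
    · rw [abs_of_nonpos (by linarith)]; ring
  have e1 : |a * cornerSign v f 1 / 2| = a / 2 := by
    rcases hs1 with h | h <;> rw [h]
    · rw [abs_of_nonneg (by linarith)]; ring
    · rw [abs_of_nonpos (by linarith)]; ring
  rw [e0, e1] at hl
  have ha : a = 1 / 2 := by linarith
  rw [hre, ha] at hsg0
  rw [him, ha] at hsg1
  -- the signs agree, so the corners agree
  refine hne (corner_ext hv' hv fun i ↦ ?_)
  fin_cases i
  · show cornerSign v' f 0 = cornerSign v f 0
    rcases hs0 with h0 | h0 <;> rcases hs0' with h0' | h0' <;> simp only [h0, h0'] at hsg0 ⊢ <;> norm_num at hsg0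
  · show cornerSign v' f 1 = cornerSign v f 1
    rcases hs1 with h1 | h1 <;> rcases hs1' with h1' | h1' <;> simp only [h1, h1'] at hsg1 ⊢ <;> norm_num at hsg1

/-- **The segment `[v, c_f]` meets only the corner cut of `(v, f)`**: it is disjoint from the
corner cut of every other corner `(v', f')`. [folklore] -/
theorem segment_meshPoint_faceCenter_disjoint_cornerCut {v f v' f' : Site 2} (hv : IsCorner v f)
    (hv' : IsCorner v' f') (hne : (v', f') ≠ (v, f)) :
    Disjoint (segment ℝ (meshPoint 1 v) (faceCenter f)) (cornerCut v' f') := by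
  rw [Set.disjoint_left]
  intro p hp hp'
  by_cases hf : f' = f
  · subst hf
    exact segment_meshPoint_faceCenter_disjoint_cornerCut_of_ne' hv hv'
      (fun h ↦ hne (by rw [h])) hp hp'
  · exact segment_meshPoint_faceCenter_disjoint_cornerCut_of_ne hv hv' hf hp hp'

/-! ### Crossing defects of polylines -/

/-- **The crossing defect of a polyline is the sum of the defects of its segments** (relative to a
segment `[ℓ, r]` whose endpoints avoid every segment of the polyline). [folklore] -/
theorem crossInc_polylineFrom (ℓ r : ℂ) (a : ℂ) (l : List ℂ)
    (hl : ∀ p ∈ (a :: l).zip l, ℓ ∉ segment ℝ p.1 p.2) (hr : ∀ p ∈ (a :: l).zip l, r ∉ segment ℝ p.1 p.2) :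
    (polylineFrom a l).2.crossInc ℓ r =
      (((a :: l).zip l).map fun p ↦ (Path.segment p.1 p.2).crossInc ℓ r).sum := by
  induction l generalizing a with
  | nil =>
    show (Path.refl a).crossInc ℓ r = _
    simp [Path.crossInc_refl]
  | cons b l ih =>
    have hab : (a, b) ∈ (a :: b :: l).zip (b :: l) := by simp
    have htail : ∀ p ∈ (b :: l).zip l, p ∈ (a :: b :: l).zip (b :: l) := fun p hp ↦ by
      rw [List.zip_cons_cons]; exact List.mem_cons_of_mem _ hp
    have hl₁ : ℓ ∉ Set.range (Path.segment a b) := by rw [Path.range_segment]; exact hl _ hab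
    have hr₁ : r ∉ Set.range (Path.segment a b) := by rw [Path.range_segment]; exact hr _ hab
    have key : ∀ {z : ℂ}, (∀ p ∈ (a :: b :: l).zip (b :: l), z ∉ segment ℝ p.1 p.2) →
        z ∉ Set.range (polylineFrom b l).2 := by
      intro z hz hmem
      rw [range_polylineFrom_eq] at hmem
      rcases hmem with hzb | hmem
      · rw [Set.mem_singleton_iff] at hzb
        exact hz _ hab (hzb ▸ right_mem_segment _ _ _)
      · simp only [Set.mem_iUnion, exists_prop] at hmem
        obtain ⟨p, hp, hzp⟩ := hmem
        exact hz p (htail p hp) hzp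
    show ((Path.segment a b).trans (polylineFrom b l).2).crossInc ℓ r = _
    rw [Path.crossInc_trans _ _ hl₁ (key hl) hr₁ (key hr),
      ih b (fun p hp ↦ hl p (htail p hp)) (fun p hp ↦ hr p (htail p hp)), List.zip_cons_cons,
      List.map_cons, List.sum_cons]

/-! ### The jump relation -/

/-- The winding number of the class of a path, unfolded to the prelude's `Literature.Topology.PlaneTopology.wind`. [folklore] -/
theorem wind_mk_toContinuousMap {x y : ℂ} (P : Path x y) (z : ℂ) :
    (RandomPlanarGeometry.CurveClass.mk ⟨P.toContinuousMap⟩).wind z = Literature.Topology.PlaneTopology.wind fun t ↦ P.extend t - z := rfl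

/-- The darts of a list: the `i`-th cyclically consecutive pair belongs to `γ.zip (γ.rotate 1)`.
[folklore] -/
theorem getElem_mem_zip_rotate {γ : List MedialVertex} {i : ℕ} (hi : i < γ.length) :
    (γ[i], γ[(i + 1) % γ.length]'(Nat.mod_lt _ (Nat.zero_lt_of_lt hi))) ∈ γ.zip (γ.rotate 1) := by
  have hi' : i < (γ.zip (γ.rotate 1)).length := by simpa using hi
  have := List.getElem_mem hi'
  simp only [List.getElem_zip, List.getElem_rotate] at this
  convert this using 3

/-- **Gradient of the winding number across a corner cut**: for a corner `(v, f)` and an interface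
loop `γ` (mesh `1`, unrotated), `wind(γ, v) − wind(γ, c_f)` is `1` if the dart of `(v, f)` belongs to
`γ` and `0` otherwise — the winding number jumps by one exactly across the darts, with the primal
vertex (on the left of the dart) on the high side. Proof: the crossing defect of the loop
relative to the segment `[v, c_f]` is `2πi (wind v − wind c_f)` (`Path.crossInc_loop`), and it is the
sum of the defects of the darts (`crossInc_polylineFrom`): `2πi` for the dart of `(v, f)`, which
crosses `[v, c_f]` once from the positive to the negative side (`Path.crossInc_segment_of_cross`),
if it belongs to `γ`, and `0` for every other dart, whose corner cut misses `[v, c_f]`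
(`segment_meshPoint_faceCenter_disjoint_cornerCut`, `Path.crossInc_eq_zero`). No Jordan curve
theorem is involved. (DKKMO 2020, §1.1: loops "oriented such that the primal cluster lies on
their left"; Grimmett 1999, §11.2.) [cite: arXiv201211672, §1.1] -/
theorem IsInterfaceLoop.wind_meshPoint_sub_wind_faceCenter {ω : BondConfig (Site 2)}
    {γ : List MedialVertex} (h : IsInterfaceLoop ω γ) {v f : Site 2} (hv : IsCorner v f) :
    (loopCurve 1 0 γ).wind (meshPoint 1 v) - (loopCurve 1 0 γ).wind (faceCenter f) =
      if (cornerSource v f, cornerTarget v f) ∈ γ.zip (γ.rotate 1) then 1 else 0 := by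
  classical
  obtain ⟨a, rest, hγ⟩ := List.exists_cons_of_ne_nil h.ne_nil
  set m : MedialVertex → ℂ := medialPoint 1 with hm
  set ℓ : ℂ := meshPoint 1 v with hℓ
  set r : ℂ := faceCenter f with hr
  set xs : List ℂ := (rest ++ [a]).map m with hxs
  set P := (polylineFrom (m a) xs).2 with hP
  have hpts : (γ ++ γ.take 1).map (medialPoint 1) = m a :: xs := by subst hγ; simp [hxs, hm]
  have hcurve : loopCurve 1 0 γ = RandomPlanarGeometry.CurveClass.mk ⟨P.toContinuousMap⟩ := by
    rw [loopCurve_one_zero, hpts]; rfl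
  have hend : (polylineFrom (m a) xs).1 = m a := by rw [polylineFrom_fst]; simp [hxs]
  have hrange : Set.range P = (loopCurve 1 0 γ).range := by rw [hcurve]; rfl
  -- `ℓ`, `r` are off the trace
  have hoff : ∀ {z : ℂ}, Real.sqrt 2 / 4 ≤ Metric.infDist z (loopCurve 1 0 γ).range → z ∉ Set.range P := by
    intro z hz hmem
    rw [hrange] at hmem
    have h0 : Metric.infDist z (loopCurve 1 0 γ).range = 0 := Metric.infDist_zero_of_mem hmem
    have : (0 : ℝ) < Real.sqrt 2 / 4 := by positivity
    linarith
  have hℓP : ℓ ∉ Set.range P := hoff (h.le_infDist_meshPoint v)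
  have hrP : r ∉ Set.range P := hoff (h.le_infDist_faceCenter f)
  -- the segments of the polyline are the darts
  have hzip : (m a :: xs).zip xs = (γ.zip (γ.rotate 1)).map (Prod.map m m) := by
    subst hγ
    have e1 : m a :: xs = ((a :: rest) ++ [a]).map m := by simp [hxs]
    have e2 : xs = ((rest ++ [a]) ++ []).map m := by simp [hxs]
    rw [List.rotate_cons_succ, List.rotate_zero, e1, e2, List.zip_map, List.zip_append (by simp)]
    simp
  have hsegsub : ∀ p ∈ (m a :: xs).zip xs, segment ℝ p.1 p.2 ⊆ Set.range P := by
    intro p hp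
    rw [hP, range_polylineFrom_eq]
    exact fun x hx ↦ Or.inr (Set.mem_iUnion₂.2 ⟨p, hp, hx⟩)
  -- (A) the defect of the loop is `2πi (wind ℓ - wind r)`
  have hwind : ∀ {z : ℂ}, z ∉ Set.range P → P.argInc z = (loopCurve 1 0 γ).wind z * (2 * π * I) := by
    intro z hz
    rw [hcurve, wind_mk_toContinuousMap]
    unfold Path.argInc
    refine Literature.Topology.PlaneTopology.logInc_eq_wind_mul ⟨(P.continuous_extend.continuousOn).sub continuousOn_const,
      fun t ht h0 ↦ ?_, ?_⟩
    · rw [sub_eq_zero, Path.extend_apply P ht] at h0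
      exact hz ⟨_, h0⟩
    · show P.extend 0 - z = P.extend 1 - z
      rw [Path.extend_zero, Path.extend_one, hend]
  have hA : P.crossInc ℓ r =
      ((loopCurve 1 0 γ).wind ℓ - (loopCurve 1 0 γ).wind r : ℂ) * (2 * π * I) := by
    unfold Path.crossInc
    rw [hwind hℓP, hwind hrP, hend, sub_self, sub_zero]
    ring
  -- (B) the defect of the loop is the sum over the darts: `2πi` or `0`
  set d₀ : MedialVertex × MedialVertex := (cornerSource v f, cornerTarget v f) with hd₀
  have hB : P.crossInc ℓ r = (if d₀ ∈ γ.zip (γ.rotate 1) then 1 else 0 : ℂ) * (2 * π * I) := by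
    rw [hP, crossInc_polylineFrom ℓ r (m a) xs (fun p hp hx ↦ hℓP (hsegsub p hp hx))
      (fun p hp hx ↦ hrP (hsegsub p hp hx)), hzip, List.map_map]
    set g : MedialVertex × MedialVertex → ℂ :=
      (fun p : ℂ × ℂ ↦ (Path.segment p.1 p.2).crossInc ℓ r) ∘ Prod.map m m with hg
    -- every other dart misses `[ℓ, r]`
    have hg0 : ∀ q ∈ γ.zip (γ.rotate 1), q ≠ d₀ → g q = 0 := by
      rintro ⟨e, e'⟩ hq hne
      obtain ⟨v', f', hv', hs, ht, hseg⟩ := (h.isMedialDart_of_mem_zip hq).exists_segment_eq_cornerCut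
      have hne' : (v', f') ≠ (v, f) := by
        rintro ⟨⟩
        exact hne (Prod.ext hs.symm ht.symm)
      have hdisj := segment_meshPoint_faceCenter_disjoint_cornerCut hv hv' hne'
      show (Path.segment (m e) (m e')).crossInc ℓ r = 0
      refine Path.crossInc_eq_zero _ fun t ht ↦ ?_
      have hmem : (Path.segment (m e) (m e')) t ∈ cornerCut v' f' := by
        rw [← hseg, ← Path.range_segment (m e) (m e')]
        exact ⟨t, rfl⟩
      exact Set.disjoint_left.1 hdisj ht hmem
    -- the dart of `(v, f)` crosses once, positively
    have hg1 : g d₀ = 2 * π * I :=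
      Path.crossInc_segment_of_cross (segSide_source_pos hv) (segSide_target_neg hv)
        (exists_mem_cornerCut_mem_openSegment hv)
    rw [← List.sum_toFinset g h.nodup]
    split_ifs with hd
    · rw [Finset.sum_eq_single_of_mem d₀ (List.mem_toFinset.2 hd)
        (fun q hq hne ↦ hg0 q (List.mem_toFinset.1 hq) hne), hg1, one_mul]
    · rw [zero_mul]
      exact Finset.sum_eq_zero fun q hq ↦ hg0 q (List.mem_toFinset.1 hq)
        (fun heq ↦ hd (heq ▸ List.mem_toFinset.1 hq))
  -- (C) compare
  have hI : (2 * π * I : ℂ) ≠ 0 := by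
    simp [Real.pi_ne_zero, Complex.I_ne_zero]
  have hC : ((loopCurve 1 0 γ).wind ℓ - (loopCurve 1 0 γ).wind r : ℂ) =
      (if d₀ ∈ γ.zip (γ.rotate 1) then 1 else 0 : ℂ) :=
    mul_right_cancel₀ hI (hA.symm.trans hB)
  split_ifs at hC ⊢ with hd <;> exact_mod_cast hC

/-- **Jump relation**: for the corner `(v, f)` of a dart of an interface loop `γ` (mesh `1`,
unrotated), `wind(γ, v) = wind(γ, c_f) + 1` — the primal vertex on the left of the dart has winding
number one more than the centre of the face on its right. (DKKMO 2020, §1.1: loops "oriented such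
that the primal cluster lies on their left".) [cite: arXiv201211672, §1.1] -/
theorem IsInterfaceLoop.wind_meshPoint_eq_wind_faceCenter_add_one {ω : BondConfig (Site 2)}
    {γ : List MedialVertex} (h : IsInterfaceLoop ω γ) {v f : Site 2} (hv : IsCorner v f)
    (hd : (cornerSource v f, cornerTarget v f) ∈ γ.zip (γ.rotate 1)) :
    (loopCurve 1 0 γ).wind (meshPoint 1 v) = (loopCurve 1 0 γ).wind (faceCenter f) + 1 := by
  have := h.wind_meshPoint_sub_wind_faceCenter hv
  rw [if_pos hd] at this
  omega

/-- **No jump off the loop**: if the dart of the corner `(v, f)` does not belong to the interface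
loop, `v` and `c_f` have the same winding number. [cite: arXiv201211672, §1.1] -/
theorem IsInterfaceLoop.wind_meshPoint_eq_wind_faceCenter {ω : BondConfig (Site 2)}
    {γ : List MedialVertex} (h : IsInterfaceLoop ω γ) {v f : Site 2} (hv : IsCorner v f)
    (hd : (cornerSource v f, cornerTarget v f) ∉ γ.zip (γ.rotate 1)) :
    (loopCurve 1 0 γ).wind (meshPoint 1 v) = (loopCurve 1 0 γ).wind (faceCenter f) := by
  have := h.wind_meshPoint_sub_wind_faceCenter hv
  rw [if_neg hd] at this
  omega

/-- The jump relation at the `i`-th dart. [cite: arXiv201211672, §1.1] -/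
theorem IsInterfaceLoop.exists_corner_wind_eq_add_one {ω : BondConfig (Site 2)}
    {γ : List MedialVertex} (h : IsInterfaceLoop ω γ) {i : ℕ} (hi : i < γ.length) :
    ∃ v f : Site 2, IsCorner v f ∧ cornerSource v f = γ[i] ∧
      cornerTarget v f = γ[(i + 1) % γ.length]'(Nat.mod_lt _ h.length_pos) ∧
      (loopCurve 1 0 γ).wind (meshPoint 1 v) = (loopCurve 1 0 γ).wind (faceCenter f) + 1 := by
  obtain ⟨v, f, hv, hs, ht⟩ := h.isMedialDart i hi
  refine ⟨v, f, hv, hs, ht, h.wind_meshPoint_eq_wind_faceCenter_add_one hv ?_⟩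
  rw [hs, ht]
  exact getElem_mem_zip_rotate hi

/-- **Every interface loop has a fat point of non-zero winding number** (mesh `1`, unrotated):
a point at distance `≥ √2/4` from the trace around which the loop winds. Indeed for the corner
`(v, f)` of any dart, `wind v = wind c_f + 1`, so one of `v`, `c_f` has non-zero winding number,
and both are `√2/4`-far from the trace (`MedialGridDistances`). [cite: arXiv201211672, §1.1] -/
theorem IsInterfaceLoop.exists_fat_wind_ne_zero {ω : BondConfig (Site 2)} {γ : List MedialVertex}
    (h : IsInterfaceLoop ω γ) :
    ∃ z : ℂ, Real.sqrt 2 / 4 ≤ Metric.infDist z (loopCurve 1 0 γ).range ∧ (loopCurve 1 0 γ).wind z ≠ 0 := by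
  obtain ⟨v, f, -, -, -, hj⟩ := h.exists_corner_wind_eq_add_one h.length_pos
  by_cases h0 : (loopCurve 1 0 γ).wind (faceCenter f) = 0
  · exact ⟨meshPoint 1 v, h.le_infDist_meshPoint v, by rw [hj, h0]; norm_num⟩
  · exact ⟨faceCenter f, h.le_infDist_faceCenter f, h0⟩

end Literature.Probability.Percolation

end
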